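import Mathlib
import HarnessLib

/-!
# Unique continuation under partial analyticity (Tataru 1999 / Robbiano–Zuily 1998 / Hörmander 1997),
# scalar second-order case with void pseudo-convexity conditions (named fact, D-0014)

D. Tataru, *Unique continuation for operators with partially analytic coefficients*, J. Math. Pures
Appl. **78** (1999) 505–521, Thm. 1; L. Robbiano, C. Zuily, *Uniqueness in the Cauchy problem for
operators with partially holomorphic coefficients*, Invent. Math. **131** (1998) 493–539, Thm. A;
L. Hörmander, *On the uniqueness of the Cauchy problem under partial analyticity assumptions*, in:
Geometrical Optics and Related Topics (Cortona 1996), PNLDE 32, Birkhäuser 1997, 179–219, Thm. 1.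
These interpolate between Holmgren's theorem (all variables analytic: uniqueness across every
non-characteristic surface) and Hörmander's theorem (no analyticity: uniqueness across strongly
pseudo-convex surfaces): if the coefficients of `P` are analytic in a group of variables `x_a` (and
smooth in the others), the strong pseudo-convexity of the surface is required ONLY on the conormal set
`Γ = {ξ_a = 0}`.

We record the special case in which both residual conditions are VOID, which is the form consumed
by the line `Sketch` (idea `azimuthal-partial-analyticity`) of the crux `NonTrappingHawkingRigidity`
of the summit `FinalStateConjecture`: a scalar operator of order two on an open subset of `ℝ⁴` with
real, nondegenerate principal part `aⁱʲ(x) ∂ᵢ∂ⱼ`, two analytic variables `x_a = (x⁰, x¹)`, the residual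
characteristic set `{ξ : aⁱʲ(x₀)ξᵢξⱼ = 0, ξ₀ = ξ₁ = 0}` reduced to `{0}` (for a Lorentzian `aⁱʲ` this says
that the coordinate 2-plane `span{∂₀, ∂₁}` is timelike at `x₀`: its annihilator is spacelike), and a
non-characteristic level surface `{φ = φ(x₀)}` — then the real condition lives on the empty set
`Γ ∩ Char ∖ 0`, and the complex condition lives on `{p_φ = 0, {p_φ, φ} = 0, τ > 0}`, empty as well since
`{p_φ, φ}(x₀, ξ, τ) = 2a(ξ, dφ) + 2iτ a(dφ, dφ)` has non-zero imaginary part (this reduction for real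
second-order symbols is Hörmander, ALPDO IV §28.3, and Laurent–Léautaud's lectures, Lemma 3.6).
Conclusion: a smooth solution of `P u = 0` vanishing on the sub-level side vanishes near `x₀`.

* `Literature.Analysis.PDE.Tataru1999_partialAnalyticUniqueContinuation` — the named fact.

Rendering choices.  Everything is stated on `E4 = EuclideanSpace ℝ (Fin 4)` with the coordinate
directions `EuclideanSpace.single i 1`; derivatives are Mathlib's `fderiv` / `iteratedFDeriv`; ALL
coefficients (principal AND lower order — with a merely smooth zeroth-order term the statement is false,
Alinhac–Baouendi) are `C^∞` on `Ω` and PARTIALLY ANALYTIC in `(x⁰, x¹)` UNIFORMLY near `x₀`, rendered by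
uniform factorial bounds on the iterated derivatives in the two directions `e₀, e₁` on a ball about `x₀`
(`‖Dᵏκ(z)(v₁,…,v_k)‖ ≤ M Cᵏ k!`, `vᵢ ∈ {e₀, e₁}`) — slice-wise this is the Cauchy-estimate
characterisation of real-analyticity (Krantz–Parks 2002, Prop. 2.2.10; the tree's
`Literature/Analysis/Calculus/AnalyticCauchyEstimates`, `AnalyticOfFDerivBound`), uniformly in the other
variables, i.e. the class "`C^∞`, analytic in `x_a`" of Robbiano–Zuily / Hörmander (uniform holomorphic
extension to a complex strip in `z_a`).  The solution is taken `C^∞` (Tataru asks far less).  This is a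
LITERAL special case of the printed theorems (scalar, `m = 2`, smooth data), weaker in every hypothesis.

Deliberately NOT here: the general order-`m` statement with the two pseudo-convexity conditions on
`Γ`, the `H^{m−1}` regularity threshold, operators with complex symbols (Tataru's transversality
condition), systems (Eller–Isakov–Nakamura–Tataru 2002), and the quantitative versions
(Laurent–Léautaud, JEMS 21 (2019)).  No proof is attempted (Carleman estimates with partially analytic
FBI-type weights).

## References

* D. Tataru, J. Math. Pures Appl. 78 (1999) 505–521, Thm. 1. [Tataru1999PartiallyAnalytic]
* L. Robbiano, C. Zuily, Invent. Math. 131 (1998) 493–539, Thm. A. [RobbianoZuily1998]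
* L. Hörmander, Cortona 1996 proceedings (1997), 179–219, Thm. 1. [Hormander1997PartialAnalyticity]
* S. G. Krantz, H. R. Parks, A Primer of Real Analytic Functions, 2nd ed. (2002), Prop. 2.2.10.
  [KrantzParks2002]
-/

noncomputable section

open Set Metric
open scoped Topology ContDiff Nat

namespace Literature.Analysis.PDE

/-- **Tataru 1999, Thm. 1 / Robbiano–Zuily 1998, Thm. A / Hörmander 1997, Thm. 1 — scalar second-order
case with void residual conditions.**  Data on an open `Ω ⊆ ℝ⁴` containing `x₀`: real coefficients
`aⁱʲ, bⁱ, c`, smooth on `Ω`, of `P u = ∑ᵢⱼ aⁱʲ ∂ᵢ∂ⱼu + ∑ᵢ bⁱ ∂ᵢu + c u`; a smooth level function `f` (written `φ` above; `φ` is Mathlib notation for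
`Nat.totient` under `open scoped Nat`); a smooth solution `u` of `P u = 0` on `Ω`.  Hypotheses at `x₀`: the form `(aⁱʲ(x₀))` is nondegenerate; the
residual characteristic set is trivial, `aⁱʲ(x₀)ξᵢξⱼ = 0 ∧ ξ₀ = ξ₁ = 0 ⇒ ξ = 0`; the level surface
`{f = f x₀}` is non-characteristic, `aⁱʲ(x₀)∂ᵢf ∂ⱼf ≠ 0`; and every coefficient is analytic in
`(x⁰, x¹)` uniformly near `x₀` (uniform factorial bounds on the `e₀/e₁`-directional iterated derivatives
on a ball about `x₀` inside `Ω`).  Conclusion: if `u = 0` on `Ω ∩ {f < f x₀}` then `u = 0` on a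
neighbourhood of `x₀`.  (Both pseudo-convexity conditions of the printed theorem are void here — the
real one lives on `Γ ∩ Char ∖ 0 = ∅`, the complex one on `{p_φ = {p_φ, φ} = 0} = ∅` for a
non-characteristic surface and a real second-order symbol —, so this is a literal special case.)
[cite: Tataru1999PartiallyAnalytic, Thm. 1] -/
def Tataru1999_partialAnalyticUniqueContinuation : Prop :=
  ∀ (Ω : Set (EuclideanSpace ℝ (Fin 4))) (x₀ : EuclideanSpace ℝ (Fin 4))
    (a : Fin 4 → Fin 4 → EuclideanSpace ℝ (Fin 4) → ℝ) (b : Fin 4 → EuclideanSpace ℝ (Fin 4) → ℝ)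
    (c f u : EuclideanSpace ℝ (Fin 4) → ℝ),
    IsOpen Ω → x₀ ∈ Ω →
    -- regularity: smooth coefficients, level function and solution on `Ω`
    (∀ i j, ContDiffOn ℝ ∞ (a i j) Ω) → (∀ i, ContDiffOn ℝ ∞ (b i) Ω) → ContDiffOn ℝ ∞ c Ω →
    ContDiffOn ℝ ∞ f Ω → ContDiffOn ℝ ∞ u Ω →
    -- real principal type at `x₀`: the form `(aⁱʲ(x₀))` is nondegenerate
    (∀ ξ : EuclideanSpace ℝ (Fin 4), (∀ η : EuclideanSpace ℝ (Fin 4), ∑ i, ∑ j, a i j x₀ * ξ i * η j = 0) →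
      ξ = 0) →
    -- trivial residual characteristic set in `Γ = {ξ₀ = ξ₁ = 0}` at `x₀`
    (∀ ξ : EuclideanSpace ℝ (Fin 4), ξ 0 = 0 → ξ 1 = 0 → ∑ i, ∑ j, a i j x₀ * ξ i * ξ j = 0 → ξ = 0) →
    -- the level hypersurface `{f = f x₀}` is non-characteristic at `x₀`
    (∑ i, ∑ j, a i j x₀ * fderiv ℝ f x₀ (EuclideanSpace.single i 1) *
        fderiv ℝ f x₀ (EuclideanSpace.single j 1) ≠ 0) →
    -- two-variable analyticity of ALL coefficients, uniformly near `x₀` (factorial bounds in `e₀, e₁`)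
    (∀ κ : EuclideanSpace ℝ (Fin 4) → ℝ, (κ = c ∨ (∃ i, κ = b i) ∨ ∃ i j, κ = a i j) →
      ∃ δ > (0 : ℝ), ∃ M C : ℝ, 0 ≤ M ∧ 0 ≤ C ∧ ball x₀ δ ⊆ Ω ∧
        ∀ z ∈ ball x₀ δ, ∀ (k : ℕ) (v : Fin k → EuclideanSpace ℝ (Fin 4)),
          (∀ i, v i = EuclideanSpace.single 0 1 ∨ v i = EuclideanSpace.single 1 1) →
          ‖iteratedFDeriv ℝ k κ z v‖ ≤ M * C ^ k * k !) →
    -- the equation `P u = 0` on `Ω`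
    (∀ x ∈ Ω,
      ∑ i, ∑ j, a i j x *
          fderiv ℝ (fun y ↦ fderiv ℝ u y (EuclideanSpace.single j 1)) x (EuclideanSpace.single i 1) +
        ∑ i, b i x * fderiv ℝ u x (EuclideanSpace.single i 1) + c x * u x = 0) →
    -- `u` vanishes on the sub-level side
    (∀ x ∈ Ω, f x < f x₀ → u x = 0) →
    ∃ V : Set (EuclideanSpace ℝ (Fin 4)), IsOpen V ∧ x₀ ∈ V ∧ ∀ x ∈ V, u x = 0

end Literature.Analysis.PDE

end
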